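import Mathlib
import HarnessLib

/-!
# SoloInformed — log-room estimates I: one-variable cores (LEMMA I programme, file F1a)

Solo programme `solo-KontsevichZagierPeriods-informed`, session s140.  First file of the kernel
**LEMMA I programme**: *integrability loci of `ℚ`-semialgebraic families are `ℚ`-semialgebraic*,
conditional on the vendored Lion–Rolin–Kaiser preparation theorem
`Literature.ModelTheory.ExponentialFields.semialgebraicPreparation`; it removes the bounded-chain
restriction from THEOREM R (`soloInformed_realParameterBarrier`).  The real-coefficient version of
LEMMA I is [Comte–Lion–Rolin 2000, Thm. 3]; the `ℚ`-version is proved in this programme by a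
`ℚ`-preserving preparation argument whose one-variable analysis starts here.

This file is the one-variable measure-theoretic toolbox used by the ONE-VARIABLE LOG-ROOM LEMMA
(file F1b) and the LOG-ROOM THEOREM (file F4):
* exact values of `∫⁻ u^s` over `(0, m)` (`-1 < s`) and `(a, ∞)` (`s < -1`), and divergence in the
  complementary exponent ranges;
* translation / reflection of set integrals over intervals, a lower bound by a constant;
* the elementary power-mean inequality `(x + y)^p ≤ 2^p (x^p + y^p)` and `log⁺` bookkeeping
  (`|log x| ≤ log⁺ x + log⁺ x⁻¹`, `log⁺ (max a b) ≤ log⁺ a + log⁺ b`, `log⁺ x ≤ 1 + x`-type bounds),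
  and the absorption `log (m / u) ≤ (m / u)^ε / ε` (`Real.log_le_rpow_div`).

References: G. Comte, J.-M. Lion, J.-P. Rolin, *Nature log-analytique du volume des
sous-analytiques*, Illinois J. Math. 44 (2000) 884–888, Thm. 3; J.-M. Lion, J.-P. Rolin, Ann. Inst.
Fourier 48 (1998) 755–767, Thm. 1; T. Kaiser, Ann. Polon. Math. 87 (2005), Thm. 2.1.  Everything in
this file is folklore calculus.
-/

noncomputable section

open scoped ENNReal
open MeasureTheory Set Real

namespace Summit.KontsevichZagierPeriods.KontsevichZagierPeriods.Theorems

/-! ### Elementary real inequalities -/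

/-- Power-mean inequality with a generous constant: `(x + y)^p ≤ 2^p (x^p + y^p)` for
`x, y ≥ 0`. [cite: ComteLionRolin2000, Thm. 3] -/
theorem soloInformed_add_pow_le_two_pow (p : ℕ) {x y : ℝ} (hx : 0 ≤ x) (hy : 0 ≤ y) :
    (x + y) ^ p ≤ 2 ^ p * (x ^ p + y ^ p) := by
  rcases le_total x y with h | h
  · calc (x + y) ^ p ≤ (2 * y) ^ p := by gcongr; linarith
      _ = 2 ^ p * y ^ p := mul_pow 2 y p
      _ ≤ 2 ^ p * (x ^ p + y ^ p) := by gcongr; linarith [pow_nonneg hx p]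
  · calc (x + y) ^ p ≤ (2 * x) ^ p := by gcongr; linarith
      _ = 2 ^ p * x ^ p := mul_pow 2 x p
      _ ≤ 2 ^ p * (x ^ p + y ^ p) := by gcongr; linarith [pow_nonneg hy p]

/-- Three-term power-mean inequality: `(x + y + z)^p ≤ 4^p (x^p + y^p + z^p)` for
`x, y, z ≥ 0`. [cite: ComteLionRolin2000, Thm. 3] -/
theorem soloInformed_add_add_pow_le (p : ℕ) {x y z : ℝ} (hx : 0 ≤ x) (hy : 0 ≤ y) (hz : 0 ≤ z) :
    (x + y + z) ^ p ≤ 4 ^ p * (x ^ p + y ^ p + z ^ p) := by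
  have h1 := soloInformed_add_pow_le_two_pow p (add_nonneg hx hy) hz
  have h2 := soloInformed_add_pow_le_two_pow p hx hy
  have h4 : (4 : ℝ) ^ p = 2 ^ p * 2 ^ p := by rw [← mul_pow]; norm_num
  have h2p : (1 : ℝ) ≤ 2 ^ p := one_le_pow₀ (by norm_num)
  calc (x + y + z) ^ p ≤ 2 ^ p * ((x + y) ^ p + z ^ p) := h1
    _ ≤ 2 ^ p * (2 ^ p * (x ^ p + y ^ p) + 2 ^ p * z ^ p) := by
        gcongr
        nlinarith [pow_nonneg hz p]
    _ = 4 ^ p * (x ^ p + y ^ p + z ^ p) := by rw [h4]; ring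

/-- For `p ≥ 1` and `X ≥ 0`: `X^p + 1 ≤ 2 (1 + X)^p`. [cite: ComteLionRolin2000, Thm. 3] -/
theorem soloInformed_pow_add_one_le (p : ℕ) {X : ℝ} (hX : 0 ≤ X) :
    X ^ p + 1 ≤ 2 * (1 + X) ^ p := by
  have h1 : X ^ p ≤ (1 + X) ^ p := by gcongr; linarith
  have h2 : (1 : ℝ) ≤ (1 + X) ^ p := one_le_pow₀ (by linarith)
  linarith

/-- `|log x| ≤ log⁺ x + log⁺ x⁻¹` (from `log x = log⁺ x − log⁺ x⁻¹`). [cite: ComteLionRolin2000, Thm. 3] -/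
theorem soloInformed_abs_log_le_posLog (x : ℝ) : |Real.log x| ≤ log⁺ x + log⁺ x⁻¹ := by
  have h : Real.log x = log⁺ x - log⁺ x⁻¹ := Real.posLog_sub_posLog_inv.symm
  have h1 : 0 ≤ log⁺ x := Real.posLog_nonneg
  have h2 : 0 ≤ log⁺ x⁻¹ := Real.posLog_nonneg
  rw [h, abs_le]
  constructor <;> linarith

/-- `log⁺ (max a b) ≤ log⁺ a + log⁺ b`. [cite: ComteLionRolin2000, Thm. 3] -/
theorem soloInformed_posLog_max_le (a b : ℝ) : log⁺ (max a b) ≤ log⁺ a + log⁺ b := by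
  have h1 : 0 ≤ log⁺ a := Real.posLog_nonneg
  have h2 : 0 ≤ log⁺ b := Real.posLog_nonneg
  rcases le_total a b with h | h
  · rw [max_eq_right h]; linarith
  · rw [max_eq_left h]; linarith

/-- `log⁺ (min a b)⁻¹ ≤ log⁺ a⁻¹ + log⁺ b⁻¹`. [cite: ComteLionRolin2000, Thm. 3] -/
theorem soloInformed_posLog_inv_min_le (a b : ℝ) : log⁺ (min a b)⁻¹ ≤ log⁺ a⁻¹ + log⁺ b⁻¹ := by
  have h1 : 0 ≤ log⁺ a⁻¹ := Real.posLog_nonneg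
  have h2 : 0 ≤ log⁺ b⁻¹ := Real.posLog_nonneg
  rcases le_total a b with h | h
  · rw [min_eq_left h]; linarith
  · rw [min_eq_right h]; linarith

/-- `log⁺ x⁻¹ ≤ log⁺ y⁻¹` for `0 < y ≤ x` (antitonicity of `x ↦ log⁺ x⁻¹` on the positive axis).
[cite: ComteLionRolin2000, Thm. 3] -/
theorem soloInformed_posLog_inv_antitone {x y : ℝ} (hy : 0 < y) (hyx : y ≤ x) :
    log⁺ x⁻¹ ≤ log⁺ y⁻¹ :=
  Real.posLog_le_posLog (inv_nonneg.2 (hy.le.trans hyx)) (inv_anti₀ hy hyx)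

/-- `log⁺ x = log x` for `1 ≤ x`, restated with the hypothesis in the form used below.
[cite: ComteLionRolin2000, Thm. 3] -/
theorem soloInformed_posLog_eq_log_of_one_le {x : ℝ} (hx : 1 ≤ x) : log⁺ x = Real.log x :=
  Real.posLog_eq_log (by rwa [abs_of_nonneg (zero_le_one.trans hx)])

/-- `log⁺ x = 0` for `0 ≤ x ≤ 1`. [cite: ComteLionRolin2000, Thm. 3] -/
theorem soloInformed_posLog_eq_zero_of_le_one {x : ℝ} (h0 : 0 ≤ x) (hx : x ≤ 1) : log⁺ x = 0 :=
  (Real.posLog_eq_zero_iff x).2 (by rwa [abs_of_nonneg h0])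

/-- The absorption inequality `log (m / u) ≤ (m / u)^ε / ε` (`0 < ε`, `0 ≤ m / u`), i.e.
`Real.log_le_rpow_div` at `m / u`. [cite: ComteLionRolin2000, Thm. 3] -/
theorem soloInformed_log_div_le_rpow_div {m u ε : ℝ} (hm : 0 ≤ m) (hu : 0 < u) (hε : 0 < ε) :
    Real.log (m / u) ≤ (m / u) ^ ε / ε :=
  Real.log_le_rpow_div (div_nonneg hm hu.le) hε

/-- Splitting a logarithm at a scale: for `0 < u` and `0 < m`, `log u⁻¹ = log m⁻¹ + log (m / u)`.
[cite: ComteLionRolin2000, Thm. 3] -/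
theorem soloInformed_log_inv_eq_add {m u : ℝ} (hm : 0 < m) (hu : 0 < u) :
    Real.log u⁻¹ = Real.log m⁻¹ + Real.log (m / u) := by
  rw [← Real.log_mul (inv_ne_zero hm.ne') (div_ne_zero hm.ne' hu.ne')]
  congr 1
  field_simp

/-- On `[α₀, 2α₀]` (`0 < α₀`) the power `u ↦ u^r` is pinched between `m_r := min (α₀^r) ((2α₀)^r)`
and `2^{|r|} m_r`: lower bound. [cite: ComteLionRolin2000, Thm. 3] -/
theorem soloInformed_min_rpow_le {α₀ u : ℝ} (r : ℝ) (hα : 0 < α₀) (h1 : α₀ ≤ u) (h2 : u ≤ 2 * α₀) :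
    min (α₀ ^ r) ((2 * α₀) ^ r) ≤ u ^ r := by
  rcases le_or_gt 0 r with hr | hr
  · exact (min_le_left _ _).trans (Real.rpow_le_rpow hα.le h1 hr)
  · exact (min_le_right _ _).trans (Real.rpow_le_rpow_of_nonpos (hα.trans_le h1) h2 hr.le)

/-- On `[α₀, 2α₀]` (`0 < α₀`): upper bound `u^r ≤ 2^{|r|} · min (α₀^r) ((2α₀)^r)`.
[cite: ComteLionRolin2000, Thm. 3] -/
theorem soloInformed_rpow_le_two_pow_mul_min {α₀ u : ℝ} (r : ℝ) (hα : 0 < α₀) (h1 : α₀ ≤ u)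
    (h2 : u ≤ 2 * α₀) : u ^ r ≤ (2 : ℝ) ^ |r| * min (α₀ ^ r) ((2 * α₀) ^ r) := by
  have h2α : (2 * α₀) ^ r = (2 : ℝ) ^ r * α₀ ^ r := Real.mul_rpow (by norm_num) hα.le
  have hαr : 0 ≤ α₀ ^ r := Real.rpow_nonneg hα.le r
  rcases le_or_gt 0 r with hr | hr
  · have h1r : (1 : ℝ) ≤ 2 ^ r := by
      simpa using Real.rpow_le_rpow_of_exponent_le (by norm_num : (1 : ℝ) ≤ 2) hr
    have hmin : min (α₀ ^ r) ((2 * α₀) ^ r) = α₀ ^ r := by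
      rw [min_eq_left]
      rw [h2α]
      nlinarith
    rw [hmin, abs_of_nonneg hr]
    calc u ^ r ≤ (2 * α₀) ^ r := Real.rpow_le_rpow (hα.le.trans h1) h2 hr
      _ = 2 ^ r * α₀ ^ r := h2α
  · have hle : (2 * α₀) ^ r ≤ α₀ ^ r := Real.rpow_le_rpow_of_nonpos hα (by linarith) hr.le
    rw [min_eq_right hle, abs_of_neg hr, h2α, ← mul_assoc,
      ← Real.rpow_add (by norm_num : (0 : ℝ) < 2), neg_add_cancel, Real.rpow_zero, one_mul]
    exact Real.rpow_le_rpow_of_nonpos hα h1 hr.le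

/-! ### One-variable power integrals as Lebesgue integrals in `ℝ≥0∞` -/

/-- `∫⁻_{(0,m)} u^s du = m^{s+1} / (s+1)` for `-1 < s`, `0 ≤ m`. [cite: ComteLionRolin2000, Thm. 3] -/
theorem soloInformed_lintegral_rpow_Ioo {s : ℝ} (hs : -1 < s) {m : ℝ} (hm : 0 ≤ m) :
    ∫⁻ u in Ioo 0 m, ENNReal.ofReal (u ^ s) = ENNReal.ofReal (m ^ (s + 1) / (s + 1)) := by
  have hint : IntegrableOn (fun u : ℝ => u ^ s) (Ioo 0 m) :=
    (intervalIntegral.intervalIntegrable_rpow' hs (a := 0) (b := m)).1.mono_set Ioo_subset_Ioc_self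
  have hnn : 0 ≤ᵐ[volume.restrict (Ioo (0 : ℝ) m)] fun u : ℝ => u ^ s := by
    filter_upwards [ae_restrict_mem measurableSet_Ioo] with u hu
    exact Real.rpow_nonneg hu.1.le s
  rw [← ofReal_integral_eq_lintegral_ofReal hint hnn, ← integral_Ioc_eq_integral_Ioo,
    ← intervalIntegral.integral_of_le hm, integral_rpow (Or.inl hs), Real.zero_rpow (by linarith),
    sub_zero]

/-- `∫⁻_{(a,∞)} u^s du = a^{s+1} / (-(s+1))` for `s < -1`, `0 < a`. [cite: ComteLionRolin2000, Thm. 3] -/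
theorem soloInformed_lintegral_rpow_Ioi {s : ℝ} (hs : s < -1) {a : ℝ} (ha : 0 < a) :
    ∫⁻ u in Ioi a, ENNReal.ofReal (u ^ s) = ENNReal.ofReal (a ^ (s + 1) / (-(s + 1))) := by
  have hint : IntegrableOn (fun u : ℝ => u ^ s) (Ioi a) := integrableOn_Ioi_rpow_of_lt hs ha
  have hnn : 0 ≤ᵐ[volume.restrict (Ioi a)] fun u : ℝ => u ^ s := by
    filter_upwards [ae_restrict_mem measurableSet_Ioi] with u hu
    exact Real.rpow_nonneg (ha.le.trans (le_of_lt hu)) s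
  rw [← ofReal_integral_eq_lintegral_ofReal hint hnn, integral_Ioi_rpow_of_lt hs ha]
  congr 1
  rw [div_neg, neg_div]

/-- A nonnegative measurable function which is not integrable on a set has infinite Lebesgue
integral there. [cite: ComteLionRolin2000, Thm. 3] -/
theorem soloInformed_lintegral_ofReal_eq_top_of_not_integrableOn {f : ℝ → ℝ} {S : Set ℝ}
    (hf : AEStronglyMeasurable f (volume.restrict S)) (hnn : 0 ≤ᵐ[volume.restrict S] f)
    (h : ¬ IntegrableOn f S) : ∫⁻ u in S, ENNReal.ofReal (f u) = ⊤ := by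
  by_contra htop
  apply h
  exact ⟨hf, (hasFiniteIntegral_iff_ofReal hnn).2 (lt_top_iff_ne_top.2 htop)⟩

/-- Divergence at the origin: `∫⁻_{(0,m)} u^s du = ∞` for `s ≤ -1`, `0 < m`.
[cite: ComteLionRolin2000, Thm. 3] -/
theorem soloInformed_lintegral_rpow_Ioo_eq_top {s : ℝ} (hs : s ≤ -1) {m : ℝ} (hm : 0 < m) :
    ∫⁻ u in Ioo 0 m, ENNReal.ofReal (u ^ s) = ⊤ := by
  apply soloInformed_lintegral_ofReal_eq_top_of_not_integrableOn
  · exact (ContinuousOn.rpow_const continuousOn_id fun u hu => Or.inl (ne_of_gt hu.1)).aestronglyMeasurable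
      measurableSet_Ioo
  · filter_upwards [ae_restrict_mem measurableSet_Ioo] with u hu
    exact Real.rpow_nonneg hu.1.le s
  · rw [intervalIntegral.integrableOn_Ioo_rpow_iff hm]
    exact not_lt.2 hs

/-- Divergence at infinity: `∫⁻_{(a,∞)} u^s du = ∞` for `-1 ≤ s`, `0 ≤ a`.
[cite: ComteLionRolin2000, Thm. 3] -/
theorem soloInformed_lintegral_rpow_Ioi_eq_top {s : ℝ} (hs : -1 ≤ s) {a : ℝ} (ha : 0 ≤ a) :
    ∫⁻ u in Ioi a, ENNReal.ofReal (u ^ s) = ⊤ := by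
  have key : ∫⁻ u in Ioi (a + 1), ENNReal.ofReal (u ^ s) = ⊤ := by
    apply soloInformed_lintegral_ofReal_eq_top_of_not_integrableOn
    · exact (ContinuousOn.rpow_const continuousOn_id fun u hu =>
        Or.inl (ne_of_gt (lt_of_le_of_lt (by linarith) hu))).aestronglyMeasurable measurableSet_Ioi
    · filter_upwards [ae_restrict_mem measurableSet_Ioi] with u hu
      exact Real.rpow_nonneg (by linarith [mem_Ioi.1 hu]) s
    · rw [integrableOn_Ioi_rpow_iff (by linarith)]
      exact not_lt.2 hs
  apply top_le_iff.1
  rw [← key]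
  exact lintegral_mono_set (Ioi_subset_Ioi (by linarith))

/-! ### Translation, reflection, lower bounds -/

/-- Translation of a set integral over an interval: `∫⁻_{(a, a+L)} f (u − a) du = ∫⁻_{(0,L)} f`.
[cite: ComteLionRolin2000, Thm. 3] -/
theorem soloInformed_setLIntegral_Ioo_comp_sub_right (f : ℝ → ℝ≥0∞) (a L : ℝ) :
    ∫⁻ u in Ioo a (a + L), f (u - a) = ∫⁻ s in Ioo 0 L, f s := by
  rw [← lintegral_indicator measurableSet_Ioo, ← lintegral_indicator measurableSet_Ioo,
    ← lintegral_sub_right_eq_self (fun s => (Ioo 0 L).indicator f s) a]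
  congr 1 with u
  simp only [Set.indicator]
  have : u ∈ Ioo a (a + L) ↔ u - a ∈ Ioo 0 L := by
    simp only [mem_Ioo]; constructor <;> intro h <;> constructor <;> linarith [h.1, h.2]
  by_cases hu : u ∈ Ioo a (a + L)
  · rw [if_pos hu, if_pos (this.1 hu)]
  · rw [if_neg hu, if_neg (fun h => hu (this.2 h))]

/-- Reflection of a set integral over an interval: `∫⁻_{(b−L, b)} f (b − u) du = ∫⁻_{(0,L)} f`.
[cite: ComteLionRolin2000, Thm. 3] -/
theorem soloInformed_setLIntegral_Ioo_comp_sub_left (f : ℝ → ℝ≥0∞) (b L : ℝ) :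
    ∫⁻ u in Ioo (b - L) b, f (b - u) = ∫⁻ s in Ioo 0 L, f s := by
  rw [← lintegral_indicator measurableSet_Ioo, ← lintegral_indicator measurableSet_Ioo,
    ← lintegral_sub_left_eq_self (fun s => (Ioo 0 L).indicator f s) b]
  congr 1 with u
  simp only [Set.indicator]
  have : u ∈ Ioo (b - L) b ↔ b - u ∈ Ioo 0 L := by
    simp only [mem_Ioo]; constructor <;> intro h <;> constructor <;> linarith [h.1, h.2]
  by_cases hu : u ∈ Ioo (b - L) b
  · rw [if_pos hu, if_pos (this.1 hu)]
  · rw [if_neg hu, if_neg (fun h => hu (this.2 h))]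

/-- Lower bound of a set integral by a constant on a measurable subset:
`c · vol T ≤ ∫⁻_S f` if `T ⊆ S` and `c ≤ f` on `T`. [cite: ComteLionRolin2000, Thm. 3] -/
theorem soloInformed_const_mul_volume_le_setLIntegral {S T : Set ℝ} (hTS : T ⊆ S)
    (hT : MeasurableSet T) {f : ℝ → ℝ≥0∞} {c : ℝ≥0∞} (hc : ∀ u ∈ T, c ≤ f u) :
    c * volume T ≤ ∫⁻ u in S, f u := by
  calc c * volume T = ∫⁻ _ in T, c := (setLIntegral_const T c).symm
    _ ≤ ∫⁻ u in T, f u := setLIntegral_mono' hT hc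
    _ ≤ ∫⁻ u in S, f u := lintegral_mono_set hTS

/-- Integrating an indicator against a restricted measure: `∫⁻_S 𝟙_T g = ∫⁻_{T ∩ S} g`.
[cite: ComteLionRolin2000, Thm. 3] -/
theorem soloInformed_setLIntegral_indicator {S T : Set ℝ} (hT : MeasurableSet T) (g : ℝ → ℝ≥0∞) :
    ∫⁻ u in S, T.indicator g u = ∫⁻ u in T ∩ S, g u := by
  rw [lintegral_indicator hT, Measure.restrict_restrict hT]

/-- The power `u ↦ u^γ` near an endpoint, translated: `∫⁻_{(a, a+L)} (u − a)^γ du = L^{γ+1}/(γ+1)`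
(`-1 < γ`, `0 ≤ L`). [cite: ComteLionRolin2000, Thm. 3] -/
theorem soloInformed_lintegral_rpow_sub_left_endpoint {γ : ℝ} (hγ : -1 < γ) {a L : ℝ} (hL : 0 ≤ L) :
    ∫⁻ u in Ioo a (a + L), ENNReal.ofReal ((u - a) ^ γ) = ENNReal.ofReal (L ^ (γ + 1) / (γ + 1)) := by
  rw [soloInformed_setLIntegral_Ioo_comp_sub_right (fun s => ENNReal.ofReal (s ^ γ)) a L]
  exact soloInformed_lintegral_rpow_Ioo hγ hL

/-- The power `u ↦ u^γ` near an endpoint, reflected: `∫⁻_{(b−L, b)} (b − u)^γ du = L^{γ+1}/(γ+1)`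
(`-1 < γ`, `0 ≤ L`). [cite: ComteLionRolin2000, Thm. 3] -/
theorem soloInformed_lintegral_rpow_sub_right_endpoint {γ : ℝ} (hγ : -1 < γ) {b L : ℝ} (hL : 0 ≤ L) :
    ∫⁻ u in Ioo (b - L) b, ENNReal.ofReal ((b - u) ^ γ) = ENNReal.ofReal (L ^ (γ + 1) / (γ + 1)) := by
  rw [soloInformed_setLIntegral_Ioo_comp_sub_left (fun s => ENNReal.ofReal (s ^ γ)) b L]
  exact soloInformed_lintegral_rpow_Ioo hγ hL

/-- `ofReal` bookkeeping: for `0 ≤ a`, `ofReal (a * b) = ofReal a * ofReal b`, and a product bound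
`ofReal a * X ≤ ofReal a' * X` from `a ≤ a'`. [cite: ComteLionRolin2000, Thm. 3] -/
theorem soloInformed_ofReal_mul_le_ofReal_mul {a a' : ℝ} (h : a ≤ a') (X : ℝ≥0∞) :
    ENNReal.ofReal a * X ≤ ENNReal.ofReal a' * X := by
  gcongr

/-- If the reference integral is infinite and the constant is positive, any bound of the form
`LHS ≤ ofReal C * I` holds. [cite: ComteLionRolin2000, Thm. 3] -/
theorem soloInformed_le_ofReal_mul_top {C : ℝ} (hC : 0 < C) (L : ℝ≥0∞) :
    L ≤ ENNReal.ofReal C * ⊤ := by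
  rw [ENNReal.mul_top (by rwa [Ne, ENNReal.ofReal_eq_zero, not_le])]
  exact le_top

end Summit.KontsevichZagierPeriods.KontsevichZagierPeriods.Theorems
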